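import Summits.QuantumFields.YangMills.Theorems.LuscherReductionOneSiteLevelsKacInnerData
import Summits.QuantumFields.YangMills.Theorems.LuscherReductionOneSiteLevelsLargeField
import Summits.QuantumFields.YangMills.Theorems.FemtoTransferGapSlabRayleigh

/-!
# Crux RED `RunningReduction`, line «KTR» PART 8 — stub `TT.stub_oneSiteTail`, tool 3:
# the INJECTION step and layer I of ONE read backwards (a LOWER form bound ⟹ an UPPER jump bound)

Support module for crux `RunningReduction` (route `LuscherReduction`, item stmt-QuantumFields-19978), registered stub
`TT.stub_oneSiteTail` (KTR PART 8; plan of record = ym-cruxidea-19978-2 g10's STUB-READING §3 step 2), fleet base ym-luscher-20007-p1 (gen 4).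

In the B-uniform window count the direction of every inequality of ONE's INNER lane is reversed: one starts from a physical `ψ` whose
Rayleigh quotient is LARGE (`μ‖ψ‖² ≤ ⟨ψ, K_Bψ⟩`, `μ` close to `linkCE B`) and must show that its toron-ball piece `cos Θ_B ψ` is non-zero,
still has a large quotient, and therefore a SMALL jump energy.  Contents:

* `cos_piece_of_window` — INJECTION (pure bookkeeping): from the IMS inequality along `Θ_B` with cost `D`, a k-uniform OUTER gain `γ` on the
  `sin Θ_B`-piece and the window condition `linkCE B·(1 − γ + D) < μ`: `‖cos Θ_B ψ‖² > 0` and `(μ − linkCE B·D)‖cos Θ_B ψ‖² ≤ ⟨cos Θ_Bψ, K_B cos Θ_Bψ⟩`;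
* `cos_piece_of_window_onePhase` — the same with the tree's concrete IMS data of `Θ_B = onePhase √λ_b` (`qform_le_localized_cos_sin`,
  `defect_scale`, `onePhaseScale_lipschitzSq`: `D = (9/4)(π²/4)cM2·λ_b²`);
* `jump_le_of_qform_ge` — LAYER I BACKWARDS: for a physical `f` with `ν‖f‖² ≤ ⟨f, K_B f⟩`, `0 < ν`, `‖f‖² > 0`, the electric representative
  `g = e^{−BS/2} f` has `latticeJump B g + ∫ B·S·g² ≤ (linkCE B/ν − 1) ∫g²` and `(ν/linkCE B)‖f‖² ≤ ∫ g²`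
  (jump–Dirichlet identity `⟨f,K_Bf⟩ = linkCE(∫g² − latticeJump g)` and `(1 + BS)e^{−BS} ≤ 1`).

HONEST FRAMING: form bookkeeping for the ONE-SITE (`L = 1`) three-matrix `SU(2)` model, femto rung R2b1; nothing here is infinite volume,
a mass gap or Clay.  Sorry-free, no new definitions, no named-fact hypotheses.
-/

set_option autoImplicit false

noncomputable section

open MeasureTheory Filter Topology Real
open scoped Matrix ComplexConjugate BigOperators
open Literature.MathematicalPhysics.QuantumFieldTheory
open Literature.MathematicalPhysics.QuantumLattice
open Literature.Analysis.OperatorTheory.YMMatrixModel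

namespace Summit.QuantumFields.YangMills.Theorems.FemtoTransferGap.OST

open Summit.QuantumFields.YangMills.Theorems.FemtoTransferGap

/-! ### §1. Injection: the toron-ball piece of a high state is non-zero and high -/

/-- **INJECTION (abstract bookkeeping).**  Reals `q, qc, qs` (the forms of `ψ`, `cos Θψ`, `sin Θψ`), `n, nc, ns` (their squared norms,
`nc + ns = n > 0`), `L > 0`: if `μ n ≤ q`, `q ≤ qc + qs + L·D·n` (IMS), `qs ≤ L(1−γ) ns` (OUTER), `qc ≤ L·nc` (Schur) and the window
condition `L(1 − γ + D) < μ` holds, then `0 < nc` and `(μ − L·D)·nc ≤ qc`. [folklore] -/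
theorem cos_piece_abstract {q qc qs n nc ns L D γ μ : ℝ} (hn : 0 < n) (hnc : 0 ≤ nc) (hns : 0 ≤ ns) (hsum : nc + ns = n)
    (hlow : μ * n ≤ q) (hims : q ≤ qc + qs + L * D * n) (hout : qs ≤ L * (1 - γ) * ns) (hschur : qc ≤ L * nc)
    (hwin : L * (1 - γ + D) < μ) : 0 < nc ∧ (μ - L * D) * nc ≤ qc := by
  subst hsum
  have key : (μ - L * D) * nc + (μ - L * D - L * (1 - γ)) * ns ≤ qc := by
    have e1 : μ * (nc + ns) = μ * nc + μ * ns := by ring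
    have e2 : L * D * (nc + ns) = L * D * nc + L * D * ns := by ring
    have e3 : (μ - L * D) * nc + (μ - L * D - L * (1 - γ)) * ns
        = (μ * nc + μ * ns) - (L * D * nc + L * D * ns) - L * (1 - γ) * ns := by ring
    rw [e3]; rw [e1] at hlow; rw [e2] at hims
    linarith
  have hcoef : 0 < μ - L * D - L * (1 - γ) := by
    have e : L * (1 - γ + D) = L * D + L * (1 - γ) := by ring
    linarith
  constructor
  · by_contra h
    have hnc0 : nc = 0 := le_antisymm (not_lt.1 h) hnc
    have hqc : qc ≤ 0 := by rw [hnc0, mul_zero] at hschur; exact hschur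
    rw [hnc0, mul_zero, zero_add] at key
    have hns' : 0 < ns := by simpa [hnc0] using hn
    have : 0 < (μ - L * D - L * (1 - γ)) * ns := mul_pos hcoef hns'
    linarith
  · have : 0 ≤ (μ - L * D - L * (1 - γ)) * ns := mul_nonneg hcoef.le hns
    linarith

/-- **INJECTION for the crux's phase `Θ_B = onePhase √λ_b`.**  Let `B > 0`, `ψ` physical with `‖ψ‖² > 0` and `μ‖ψ‖² ≤ ⟨ψ,K_Bψ⟩`; suppose the
`sin Θ_B`-piece obeys a gain `γ`: `⟨sin Θ_Bψ, K_B sin Θ_Bψ⟩ ≤ linkCE B (1 − γ)‖sin Θ_Bψ‖²`, and the window condition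
`linkCE B·(1 − γ + D λ_b²) < μ` with `D = (9/4)(π²/4)cM2` (the IMS cost of `Θ_B`).  Then `‖cos Θ_Bψ‖² > 0` and
`(μ − linkCE B·Dλ_b²)‖cos Θ_Bψ‖² ≤ ⟨cos Θ_Bψ, K_B cos Θ_Bψ⟩`. [cite: SimonB1983DiscreteSpectrum, §3] -/
theorem cos_piece_of_window_onePhase {B μ γ : ℝ} (hB : 0 < B) {ψ : Cfg → ℝ} (hψ : IsPhys ψ) (hpos : 0 < l2 ψ ψ)
    (hlow : μ * l2 ψ ψ ≤ qform su2Rep B ψ ψ)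
    (hout : qform su2Rep B (fun U => Real.sin (onePhase (onePhaseScale B) U) * ψ U) (fun U => Real.sin (onePhase (onePhaseScale B) U) * ψ U)
      ≤ linkCE B * (1 - γ) * l2 (fun U => Real.sin (onePhase (onePhaseScale B) U) * ψ U) (fun U => Real.sin (onePhase (onePhaseScale B) U) * ψ U))
    (hwin : linkCE B * (1 - γ + 9 / 4 * (Real.pi ^ 2 / 4) * cM2 * bareLambda B ^ 2) < μ) :
    0 < l2 (fun U => Real.cos (onePhase (onePhaseScale B) U) * ψ U) (fun U => Real.cos (onePhase (onePhaseScale B) U) * ψ U) ∧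
      (μ - linkCE B * (9 / 4 * (Real.pi ^ 2 / 4) * cM2 * bareLambda B ^ 2))
          * l2 (fun U => Real.cos (onePhase (onePhaseScale B) U) * ψ U) (fun U => Real.cos (onePhase (onePhaseScale B) U) * ψ U)
        ≤ qform su2Rep B (fun U => Real.cos (onePhase (onePhaseScale B) U) * ψ U) (fun U => Real.cos (onePhase (onePhaseScale B) U) * ψ U) := by
  have hℓ : 0 < onePhaseScale B := onePhaseScale_pos hB
  set Θ : Cfg → ℝ := onePhase (onePhaseScale B) with hΘ
  have hims := qform_le_localized_cos_sin hB (measurable_onePhase _) (Λ := Real.pi / 2 / onePhaseScale B)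
    (div_nonneg (by positivity) hℓ.le) (fun U V => abs_onePhase_sub_le hℓ U V)
    (fun g U => onePhase_gaugeTransform _ g U) (fun j z hz U => onePhase_twist _ j hz U) hψ
  have hscale := defect_scale (Λ := Real.pi / 2 / onePhaseScale B) hB (onePhaseScale_lipschitzSq hB)
  have hsum := l2_cos_mul_add_l2_sin_mul (measurable_onePhase (onePhaseScale B)) hψ
  have hcP : IsPhys (fun U => Real.cos (Θ U) * ψ U) := isPhys_cos_onePhase_mul _ hψ
  have hschur : qform su2Rep B (fun U => Real.cos (Θ U) * ψ U) (fun U => Real.cos (Θ U) * ψ U)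
      ≤ linkCE B * l2 (fun U => Real.cos (Θ U) * ψ U) (fun U => Real.cos (Θ U) * ψ U) := by
    have h := qform_le_exp_neg_of_action_ge hB.le hcP (η := 0) (fun U _ => wilsonAction_su2_nonneg U)
    simpa using h
  have hCE : 0 < linkCE B := linkCE_pos hB.le
  set nc := l2 (fun U => Real.cos (Θ U) * ψ U) (fun U => Real.cos (Θ U) * ψ U) with hnc
  set ns := l2 (fun U => Real.sin (Θ U) * ψ U) (fun U => Real.sin (Θ U) * ψ U) with hns
  set n := l2 ψ ψ with hn
  set D : ℝ := 9 / 4 * (Real.pi ^ 2 / 4) * cM2 * bareLambda B ^ 2 with hD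
  -- the IMS error in the form `L·D·n`
  have hims' : qform su2Rep B ψ ψ ≤ qform su2Rep B (fun U => Real.cos (Θ U) * ψ U) (fun U => Real.cos (Θ U) * ψ U)
      + qform su2Rep B (fun U => Real.sin (Θ U) * ψ U) (fun U => Real.sin (Θ U) * ψ U) + linkCE B * D * n := by
    have herr : (1 / 2) * (9 * (Real.pi / 2 / onePhaseScale B) ^ 2 * (cM2 / B) * linkCE B) * n ≤ linkCE B * D * n := by
      have h1 : (1 / 2) * (9 * (Real.pi / 2 / onePhaseScale B) ^ 2 * (cM2 / B)) ≤ D := by rw [hD]; linarith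
      calc (1 / 2) * (9 * (Real.pi / 2 / onePhaseScale B) ^ 2 * (cM2 / B) * linkCE B) * n
          = ((1 / 2) * (9 * (Real.pi / 2 / onePhaseScale B) ^ 2 * (cM2 / B))) * linkCE B * n := by ring
        _ ≤ D * linkCE B * n := mul_le_mul_of_nonneg_right (mul_le_mul_of_nonneg_right h1 hCE.le) (l2_self_nonneg _)
        _ = linkCE B * D * n := by ring
    linarith [hims, herr]
  exact cos_piece_abstract hpos (l2_self_nonneg _) (l2_self_nonneg _) hsum hlow hims' hout hschur hwin

/-! ### §2. Layer I backwards: a lower form bound gives an upper jump bound -/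

/-- **LAYER I BACKWARDS.**  For `B > 0` and a physical `f` with `‖f‖² > 0` and `ν‖f‖² ≤ ⟨f, K_B f⟩`, `0 < ν`: with `g = e^{−BS/2}f`
(`magWeight B f`), `latticeJump B g + ∫ B·S·g² ≤ (linkCE B/ν − 1)·∫ g²` and `(ν/linkCE B)·‖f‖² ≤ ∫ g²`.
(`⟨f,K_Bf⟩ = linkCE·(∫g² − latticeJump g)`, `(1 + BS)g² = (1+BS)e^{−BS}f² ≤ f²`, and `ν ≤ linkCE B`.)
[cite: LiebYau1988, (2.9)–(2.11)] [cite: Luscher1983, §3] -/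
theorem jump_le_of_qform_ge {B ν : ℝ} (hB : 0 < B) (hν : 0 < ν) {f : Cfg → ℝ} (hf : IsPhys f) (hpos : 0 < l2 f f)
    (h : ν * l2 f f ≤ qform su2Rep B f f) :
    latticeJump B (magWeight B f) + ∫ U, B * wilsonAction su2Rep U * magWeight B f U ^ 2 ∂cfgMeasure
        ≤ (linkCE B / ν - 1) * ∫ U, magWeight B f U ^ 2 ∂cfgMeasure ∧
      ν / linkCE B * l2 f f ≤ ∫ U, magWeight B f U ^ 2 ∂cfgMeasure := by
  obtain ⟨C, hC⟩ := hf.bounded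
  have hfm := hf.measurable
  haveI := secondCountableTopology_su2
  have hSm : Measurable fun U : Cfg => wilsonAction su2Rep U := (continuous_wilsonAction su2Rep continuous_su2Rep).measurable
  have hCE : 0 < linkCE B := linkCE_pos hB.le
  -- integrability of the bounded integrands
  have hf2b : ∀ U : Cfg, |f U ^ 2| ≤ C ^ 2 := fun U => by rw [abs_pow]; exact pow_le_pow_left₀ (abs_nonneg _) (hC U) 2
  have hg2i : Integrable (fun U => magWeight B f U ^ 2) cfgMeasure :=
    integrable_cfgMeasure_of_bounded ((measurable_magWeight B hfm).pow_const 2) (C := C ^ 2)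
      fun U => by rw [abs_pow]; exact pow_le_pow_left₀ (abs_nonneg _) (magWeight_bounded hB.le hC U) 2
  have hBSexp : ∀ U : Cfg, (1 + B * wilsonAction su2Rep U) * Real.exp (-(B * wilsonAction su2Rep U)) ≤ 1 := fun U => by
    have h1 : 1 + B * wilsonAction su2Rep U ≤ Real.exp (B * wilsonAction su2Rep U) := by
      linarith [Real.add_one_le_exp (B * wilsonAction su2Rep U)]
    have h2 : Real.exp (B * wilsonAction su2Rep U) * Real.exp (-(B * wilsonAction su2Rep U)) = 1 := by
      rw [← Real.exp_add, add_neg_cancel, Real.exp_zero]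
    calc (1 + B * wilsonAction su2Rep U) * Real.exp (-(B * wilsonAction su2Rep U))
        ≤ Real.exp (B * wilsonAction su2Rep U) * Real.exp (-(B * wilsonAction su2Rep U)) :=
          mul_le_mul_of_nonneg_right h1 (Real.exp_pos _).le
      _ = 1 := h2
  have hBSi : Integrable (fun U => B * wilsonAction su2Rep U * magWeight B f U ^ 2) cfgMeasure := by
    refine integrable_cfgMeasure_of_bounded ((measurable_const.mul hSm).mul ((measurable_magWeight B hfm).pow_const 2))
      (C := C ^ 2) fun U => ?_
    rw [magWeight_sq, ← mul_assoc, abs_mul, abs_of_nonneg (by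
      have := wilsonAction_su2_nonneg U; have := Real.exp_pos (-(B * wilsonAction su2Rep U)); positivity)]
    have hS0 := wilsonAction_su2_nonneg U
    have h3 : B * wilsonAction su2Rep U * Real.exp (-(B * wilsonAction su2Rep U)) ≤ 1 := by
      have := hBSexp U
      have h4 : 0 ≤ Real.exp (-(B * wilsonAction su2Rep U)) := (Real.exp_pos _).le
      nlinarith
    calc B * wilsonAction su2Rep U * Real.exp (-(B * wilsonAction su2Rep U)) * |f U ^ 2| ≤ 1 * C ^ 2 :=
          mul_le_mul h3 (hf2b U) (abs_nonneg _) zero_le_one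
      _ = C ^ 2 := one_mul _
  have hf2i : Integrable (fun U => f U ^ 2) cfgMeasure := integrable_cfgMeasure_of_bounded (hfm.pow_const 2) hf2b
  -- `∫ (1 + BS) g² ≤ ∫ f²`
  have hint : ∫ U, (magWeight B f U ^ 2 + B * wilsonAction su2Rep U * magWeight B f U ^ 2) ∂cfgMeasure ≤
      ∫ U, f U ^ 2 ∂cfgMeasure := by
    refine integral_mono (hg2i.add hBSi) hf2i fun U => ?_
    show magWeight B f U ^ 2 + B * wilsonAction su2Rep U * magWeight B f U ^ 2 ≤ f U ^ 2
    rw [magWeight_sq]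
    have := hBSexp U
    have h4 : 0 ≤ f U ^ 2 := sq_nonneg _
    nlinarith
  rw [integral_add hg2i hBSi] at hint
  have hl2 : l2 f f = ∫ U, f U ^ 2 ∂cfgMeasure := by unfold l2; congr 1; funext U; ring
  have hq := qform_eq_linkCE_mul_sub_latticeJump hB.le hfm hC
  set M0 := ∫ U, magWeight B f U ^ 2 ∂cfgMeasure with hM0
  set Vl := ∫ U, B * wilsonAction su2Rep U * magWeight B f U ^ 2 ∂cfgMeasure with hVl
  set J := latticeJump B (magWeight B f) with hJ
  have hJ0 : 0 ≤ J := latticeJump_nonneg hB.le _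
  -- `ν (M0 + Vl) ≤ ν ∫f² ≤ qform = L (M0 − J)`
  have key : ν * (M0 + Vl) ≤ linkCE B * (M0 - J) := by
    rw [← hq]
    calc ν * (M0 + Vl) ≤ ν * l2 f f := by rw [hl2]; exact mul_le_mul_of_nonneg_left hint hν.le
      _ ≤ qform su2Rep B f f := h
  -- `ν ≤ L`
  have hνL : ν ≤ linkCE B := by
    have h1 : qform su2Rep B f f ≤ linkCE B * l2 f f := by
      have h := qform_le_exp_neg_of_action_ge hB.le hf (η := 0) (fun U _ => wilsonAction_su2_nonneg U)
      simpa using h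
    exact le_of_mul_le_mul_right (h.trans h1) hpos
  constructor
  · -- divide by ν
    have h1 : linkCE B * J + ν * Vl ≤ (linkCE B - ν) * M0 := by linarith
    have h2 : ν * J ≤ linkCE B * J := mul_le_mul_of_nonneg_right hνL hJ0
    have h3 : ν * (J + Vl) ≤ (linkCE B - ν) * M0 := by linarith
    have h4 : J + Vl ≤ (linkCE B - ν) * M0 / ν := by
      rw [le_div_iff₀ hν]; linarith
    calc J + Vl ≤ (linkCE B - ν) * M0 / ν := h4
      _ = (linkCE B / ν - 1) * M0 := by field_simp
  · have hVl0 : 0 ≤ Vl := integral_nonneg fun U => mul_nonneg (mul_nonneg hB.le (wilsonAction_su2_nonneg U)) (sq_nonneg _)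
    have h1 : ν * l2 f f ≤ linkCE B * M0 := by
      calc ν * l2 f f ≤ qform su2Rep B f f := h
        _ = linkCE B * (M0 - J) := hq
        _ ≤ linkCE B * M0 := by nlinarith
    rw [div_mul_eq_mul_div, div_le_iff₀ hCE]
    linarith

end Summit.QuantumFields.YangMills.Theorems.FemtoTransferGap.OST

end
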